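import Literature.Analysis.FluidPDE.NSLocalAnalyticityRadiusProofs
import HarnessLib

/-!
# Bradshaw–Grujić–Kukavica local analyticity radius: the sup bound of the holomorphic extension
# at unit scale (threading the contour scheme's bound `‖Wⁿ‖ ≤ ρ₀`)

Analysis/FluidPDE proofs-layer file (theorems only, no definitions, no named facts), companion of
`NSLocalAnalyticityRadiusProofs.lean`. That file proves the named fact
`bradshawGrujicKukavica2015_local_analyticity_radius` (Bradshaw–Grujić–Kukavica 2015, Thm. 2.3 =
BGK 2016 Thm. 2.3.1: the slice `u(t)` of a locally smooth solution extends holomorphically to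
`Ω_*(t) = {x + iy : x ∈ B_*, |y| < √t/(4C₀)}`) WITHOUT a bound on the extension, through the
`q`-free small-data unit-scale core (`…_of_small`, `R = 12`) closed by the contour Picard scheme
`NSLocalAnalyticityRadiusScheme`. The scheme, however, carries a bound: every complex iterate
satisfies `‖Wⁿ(s, ζ)‖ ≤ ρ₀` on `Ω_s` (`BGK2015.picardW_spec`), `ρ₀ = 1/(16Λ)` an absolute
constant, hence so does the limit `W = picardWLim` (`BGK2015.norm_picardWLim_le` below). This is
the tree's form of the printed bound of the scheme — BGK 2015 (4.9) p. 19, "for all `n ∈ ℕ`,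
`sup_{0<t<T} ‖U_α^{(n)}(t)‖_{L^q(4B_*)} + sup_{0<t<T} ‖V_α^{(n)}(t)‖_{L^q(4B_*)} ≤ 5 M_loc`",
inherited by the limit (p. 15: "`U_α^{(n)} + iV_α^{(n)}` converge to `U_α + iV_α` in
`C((0,T₁), L^q)`"; BGK 2016 (2.1)–(2.4) pp. 29–30) — in the `ε`-regular unit-scale normalisation
of the tree's proof, where the datum is `O(√ε₀)` in `L^∞` and the bound is a sup bound.

Proved here (net literature debt 0):

* `BGK2015.norm_picardWLim_le` — `‖W(t, ζ)‖ ≤ ρ₀` on `Ω_t` for a run of the scheme;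
* `BGK2015.exists_differentiableOn_region_of_fixedPoint_norm_le` — the fixed-point extension of
  `NSLocalAnalyticityRadiusScheme` with its bound;
* `BGK2015.exists_small_unitScale_extension_norm_le` — **the small-data unit-scale core WITH the
  sup bound**: there are absolute `ε₀, C₀, K > 0` such that for every centre `x₁`, `δ > 0` and
  every smooth solution `(u,p)` of `∂ₜu + (u·∇)u = Δu − ∇p`, `div u = 0` on
  `(−δ, 144) × B(x₁, 12)` with `sup_t ‖u(t)‖_{L³(B(x₁,12))} ≤ ε₀`,
  `sup_t ‖p(t)‖_{L^{3/2}(B(x₁,12))} ≤ ε₀`, `∫₀^{144} ‖∇u(t)‖²_{L²(B(x₁,12))} dt ≤ ε₀²`, the slice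
  `u(1)` agrees on `B(x₁,1)` with a map `U` holomorphic on `localComplexTube x₁ 1 (1/(4C₀))` and
  BOUNDED THERE BY `K` (the assembly of `NSLocalAnalyticityRadiusProofs` verbatim, keeping the
  bound). Consumers at other scales rescale (`NSLocalAnalyticityRadiusScaling`: under
  `u_λ(s,y) = λu(t₀ + λ²s, x₀ + λy)` the extension scales by `λ⁻¹`, whence bounds `K/λ ∼ K'/√t`).

## References

* Z. Bradshaw, Z. Grujić, I. Kukavica, J. Differential Equations 259 (2015) 3955–3975, Thm. 2.3,
  Lemma 3.2, (4.9) and the proof of Thm. 2.1 (p. 15). [BradshawGrujicKukavica2015]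
* Z. Bradshaw, Z. Grujić, I. Kukavica, in LMS Lecture Notes 430 (CUP 2016), Thm. 2.3.1,
  (2.1)–(2.4) (pp. 29–30). [BradshawGrujicKukavica2016]
-/

noncomputable section

open MeasureTheory Set Function Filter Metric Real
open _root_.Topology
open scoped ENNReal NNReal ContDiff Laplacian InnerProductSpace RealInnerProductSpace
open Literature.Analysis.FunctionSpaces.EuclideanSpace (complexify complexify_apply norm_complexify
  complexify_injective continuous_complexify)

namespace Literature.Analysis.FluidPDE

namespace BGK2015

section Run

variable {x₁ : EuclideanSpace ℝ (Fin 3)} {c s₀ t₁ D₀ D₀' : ℝ}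
  {DATA : ℝ → EuclideanSpace ℝ (Fin 3) → EuclideanSpace ℝ (Fin 3)}
  {DATAC : ℝ → EuclideanSpace ℂ (Fin 3) → EuclideanSpace ℂ (Fin 3)} {C_B C L₀ C_H ρ₀ : ℝ}
  (hR : IsSchemeRun x₁ c s₀ t₁ D₀ D₀' DATA DATAC C_B C L₀ C_H ρ₀)
include hR

/-- **The limit of the scheme is bounded by `ρ₀` on `Ω_t`**: the bound `‖Wⁿ(t, ζ)‖ ≤ ρ₀` of every
complex iterate (`picardW_spec`) passes to the pointwise limit `W = picardWLim`.
[cite: BradshawGrujicKukavica2015, Thm. 2.3 (proof), (4.9) p. 19 and p. 15 (limit of the scheme)] -/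
theorem norm_picardWLim_le {t : ℝ} (ht : t ∈ Ioo s₀ t₁) {ζ : EuclideanSpace ℂ (Fin 3)}
    (hζ : ζ ∈ region x₁ c s₀ t) : ‖picardWLim s₀ DATA DATAC t ζ‖ ≤ ρ₀ :=
  le_of_tendsto (tendsto_picardW hR ht hζ).norm
    (Eventually.of_forall fun n => (picardW_spec hR n t ht).2.1 ζ hζ)

/-- **The fixed-point extension with its bound**: `exists_differentiableOn_region_of_fixedPoint`
of `NSLocalAnalyticityRadiusScheme` together with `‖U ζ‖ ≤ ρ₀` on `Ω_t`.
[cite: BradshawGrujicKukavica2015, Thm. 2.3 (proof, §3–§4), (4.9)] -/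
theorem exists_differentiableOn_region_of_fixedPoint_norm_le
    {v : ℝ → EuclideanSpace ℝ (Fin 3) → EuclideanSpace ℝ (Fin 3)}
    (hvm : AEStronglyMeasurable (uncurry v)
      ((volume : Measure (ℝ × EuclideanSpace ℝ (Fin 3))).restrict (Ioo s₀ t₁ ×ˢ univ)))
    (hvb : ∀ t ∈ Ioo s₀ t₁, ∀ x, ‖v t x‖ ≤ 2 * D₀)
    (hfix : ∀ t ∈ Ioo s₀ t₁, ∀ x, v t x = DATA t x - oseenDuhamel 1 s₀ v v t x)
    {t : ℝ} (ht : t ∈ Ioo s₀ t₁) :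
    ∃ U : EuclideanSpace ℂ (Fin 3) → EuclideanSpace ℂ (Fin 3), DifferentiableOn ℂ U (region x₁ c s₀ t) ∧
      (∀ ζ ∈ region x₁ c s₀ t, ‖U ζ‖ ≤ ρ₀) ∧
      ∀ x, complexify x ∈ region x₁ c s₀ t → U (complexify x) = complexify (v t x) :=
  ⟨picardWLim s₀ DATA DATAC t, differentiableOn_picardWLim hR ht,
    fun _ hζ => norm_picardWLim_le hR ht hζ,
    fun _ hx => picardWLim_complexify hR hvm hvb hfix ht hx⟩

end Run

end BGK2015

set_option maxHeartbeats 1600000 in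
open BGK2015 in
/-- **The small-data unit-scale core of Bradshaw–Grujić–Kukavica's theorem, with the sup bound of
the extension.** There are absolute constants `ε₀, C₀, K > 0` such that: for every centre `x₁`,
every `δ > 0` and every pair `(u,p)` jointly `C^∞` on `(−δ, 12²) × B(x₁, 12)` solving there
`∂ₜu + (u·∇)u = Δu − ∇p`, `div u = 0` pointwise, with `‖u(t)‖_{L³(B(x₁,12))} ≤ ε₀` and
`‖p(t)‖_{L^{3/2}(B(x₁,12))} ≤ ε₀` for all `t`, and `∫₀^{144} ‖∇u(t)‖²_{L²(B(x₁,12))} dt ≤ ε₀²`, the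
slice `u(1)` agrees on `B(x₁, 1)` with a map `U : ℂ³ → ℂ³` complex-differentiable on the local
tube `localComplexTube x₁ 1 (1/(4C₀))` and satisfying `‖U z‖ ≤ K` there. (The assembly of
`bradshawGrujicKukavica2015_local_analyticity_radius_holds` verbatim — cut-off `cutoff12`,
`ε`-regularity, the datum of the localised Oseen representation, the contour Picard scheme with
`ρ₀ = 1/(16Λ)` — keeping the scheme's bound `K = ρ₀`: the tree's form of the printed uniform bound
(4.9) of the approximations, inherited by their limit.)
[cite: BradshawGrujicKukavica2015, Thm. 2.3 and §3–§4, Lemma 3.2, (4.9) p. 19, p. 15] -/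
theorem BGK2015.exists_small_unitScale_extension_norm_le :
    ∃ ε₀ C₀ K : ℝ, 0 < ε₀ ∧ 0 < C₀ ∧ 0 < K ∧
    ∀ (x₁ : EuclideanSpace ℝ (Fin 3)) ⦃δ : ℝ⦄, 0 < δ →
      ∀ ⦃u : ℝ → EuclideanSpace ℝ (Fin 3) → EuclideanSpace ℝ (Fin 3)⦄
        ⦃p : ℝ → EuclideanSpace ℝ (Fin 3) → ℝ⦄,
        ContDiffOn ℝ ∞ (uncurry u) (Ioo (-δ) ((12 : ℝ) ^ 2) ×ˢ ball x₁ 12) →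
        ContDiffOn ℝ ∞ (uncurry p) (Ioo (-δ) ((12 : ℝ) ^ 2) ×ˢ ball x₁ 12) →
        (∀ t ∈ Ioo (-δ) ((12 : ℝ) ^ 2), ∀ x ∈ ball x₁ 12,
          deriv (fun s => u s x) t + convect (u t) (u t) x = Δ (u t) x - gradient (p t) x) →
        (∀ t ∈ Ioo (-δ) ((12 : ℝ) ^ 2), ∀ x ∈ ball x₁ 12, VectorCalculus.divergence (u t) x = 0) →
        (∀ t ∈ Ioo (-δ) ((12 : ℝ) ^ 2),
          eLpNorm (u t) 3 (volume.restrict (ball x₁ 12)) ≤ ENNReal.ofReal ε₀) →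
        (∀ t ∈ Ioo (-δ) ((12 : ℝ) ^ 2),
          eLpNorm (p t) (ENNReal.ofReal (3 / 2)) (volume.restrict (ball x₁ 12)) ≤
            ENNReal.ofReal ε₀) →
        (∫⁻ t in Ioo 0 ((12 : ℝ) ^ 2),
          eLpNorm (fun x => Real.sqrt (frobeniusNormSq (fderiv ℝ (u t) x))) 2
            (volume.restrict (ball x₁ 12)) ^ (2 : ℝ) ≤ ENNReal.ofReal (ε₀ ^ 2)) →
        ∃ U : EuclideanSpace ℂ (Fin 3) → EuclideanSpace ℂ (Fin 3),
          DifferentiableOn ℂ U (localComplexTube x₁ 1 (1 / (4 * C₀))) ∧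
          (∀ z ∈ localComplexTube x₁ 1 (1 / (4 * C₀)), ‖U z‖ ≤ K) ∧
          ∀ x ∈ ball x₁ 1, U (complexify x) = complexify (u 1 x) := by
  classical
  -- absolute constants
  obtain ⟨ε₁, K, hε₁, hK, hE⟩ := exists_forall_norm_le_of_small
  obtain ⟨C_B, hCB0, hCB⟩ := exists_norm_oseenDuhamel_le_mul (E := EuclideanSpace ℝ (Fin 3))
  obtain ⟨Cf, hCf0, hCf⟩ := exists_norm_integral_oseenKernelC_flat_le_local (n := 2)
  obtain ⟨L₀, hL₀0, hL₀, hLip⟩ := exists_bump2_lipschitz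
  obtain ⟨C_H, hCH0, hCH⟩ := exists_abs_deriv_stepH_le
  obtain ⟨L₁, L₂, hL₁0, hL₂0, hcut⟩ := exists_cutoff12_bounds
  obtain ⟨A, hA0, hA⟩ := exists_norm_locDataC_le hL₁0 hL₂0
  set Vf : ℝ := (volume (closedBall (0 : EuclideanSpace ℝ (Fin 3)) 9)).toReal ^ (1 / 3 : ℝ) with hVf
  have hVf0 : 0 ≤ Vf := Real.rpow_nonneg ENNReal.toReal_nonneg _
  -- the aperture and the complex radius
  set c : ℝ := min 1 (1 / (4 * L₀)) with hc
  have hc0 : 0 < c := lt_min one_pos (by positivity)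
  have hc1 : c ≤ 1 := min_le_left _ _
  have hcL : c * L₀ ≤ 1 / 4 := by
    have h : c ≤ 1 / (4 * L₀) := min_le_right _ _
    calc c * L₀ ≤ 1 / (4 * L₀) * L₀ := mul_le_mul_of_nonneg_right h hL₀0.le
      _ = 1 / 4 := by field_simp
  set Λ : ℝ := (1 + c * 1 * L₀ * (1 + 2 * C_H)) * Cf with hΛ
  have hΛ0 : 0 < Λ := by positivity
  set ρ₀ : ℝ := 1 / (16 * Λ) with hρ₀
  have hρ₀0 : 0 < ρ₀ := by positivity
  have hΛρ : Λ * ρ₀ = 1 / 16 := by rw [hρ₀]; field_simp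
  -- the size threshold
  set m : ℝ := min 1 (min (7 * ρ₀ / (24 * (A + 1))) (min (ρ₀ / (2 * (1 + 2 * C_B))) (1 / (16 * C_B * (1 + 2 * C_B)))))
    with hm
  have hm0 : 0 < m := lt_min one_pos (lt_min (by positivity) (lt_min (by positivity) (by positivity)))
  have hm1 : m ≤ 1 := min_le_left _ _
  have hmA : 3 * (A + 1) * m ≤ 7 * ρ₀ / 8 := by
    have h : m ≤ 7 * ρ₀ / (24 * (A + 1)) := (min_le_right _ _).trans (min_le_left _ _)
    rw [le_div_iff₀ (by positivity)] at h
    linarith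
  have hmρ : 2 * (1 + 2 * C_B) * m ≤ ρ₀ := by
    have h : m ≤ ρ₀ / (2 * (1 + 2 * C_B)) := ((min_le_right _ _).trans (min_le_right _ _)).trans (min_le_left _ _)
    rw [le_div_iff₀ (by positivity)] at h
    linarith
  have hmB : 16 * C_B * (1 + 2 * C_B) * m ≤ 1 := by
    have h : m ≤ 1 / (16 * C_B * (1 + 2 * C_B)) := ((min_le_right _ _).trans (min_le_right _ _)).trans (min_le_right _ _)
    rw [le_div_iff₀ (by positivity)] at h
    linarith
  -- the smallness parameter
  set ε₀ : ℝ := min ε₁ (min 1 (min ((m / K) ^ 2) (m / (Vf + 1)))) with hε₀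
  have hε₀0 : 0 < ε₀ := lt_min hε₁ (lt_min one_pos (lt_min (by positivity) (by positivity)))
  have hε₀1 : ε₀ ≤ ε₁ := min_le_left _ _
  have hKε : K * Real.sqrt ε₀ ≤ m := by
    have h : ε₀ ≤ (m / K) ^ 2 := ((min_le_right _ _).trans (min_le_right _ _)).trans (min_le_left _ _)
    have h2 : Real.sqrt ε₀ ≤ m / K := by
      rw [Real.sqrt_le_left (by positivity)]; exact h
    calc K * Real.sqrt ε₀ ≤ K * (m / K) := mul_le_mul_of_nonneg_left h2 hK.le
      _ = m := by field_simp
  have hVε : Vf * ε₀ ≤ m := by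
    have h : ε₀ ≤ m / (Vf + 1) := ((min_le_right _ _).trans (min_le_right _ _)).trans (min_le_right _ _)
    rw [le_div_iff₀ (by positivity)] at h
    rw [show Vf * ε₀ = ε₀ * (Vf + 1) - ε₀ by ring]
    linarith [hε₀0.le]
  -- the output constant
  set κ : ℝ := c * Real.sqrt (1 - 1 / 2) with hκ
  have hκ0 : 0 < κ := by positivity
  set C₀ : ℝ := 1 / (4 * κ) with hC₀
  have hC₀0 : 0 < C₀ := by positivity
  have hC₀κ : 1 / (4 * C₀) = κ := by rw [hC₀]; field_simp
  refine ⟨ε₀, C₀, ρ₀, hε₀0, hC₀0, hρ₀0, ?_⟩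
  intro x₁ δ hδ u p hu hp hns hdiv hu3 hp32 hgrad
  -- the solution and the cut-off
  have hsol : IsSmallCylinderSolution x₁ δ 12 ε₀ u p := .of_hypotheses hu hp hns hdiv hu3 hp32 hgrad
  have hcyl : IsCylinderSolution x₁ δ 12 u p := hsol.toIsCylinderSolution
  have hχ : IsLocCutoff x₁ 12 (cutoff12 x₁) := isLocCutoff_cutoff12 x₁
  have hL₁ : ∀ y, ‖gradient (cutoff12 x₁) y‖ ≤ L₁ := fun y => (hcut x₁ y).1
  have hL₂ : ∀ y, |(Δ (cutoff12 x₁)) y| ≤ L₂ := fun y => (hcut x₁ y).2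
  -- times
  have hI : Icc (1 / 2 : ℝ) (3 / 2) ⊆ Ioo (-δ) ((12 : ℝ) ^ 2) := fun s hs => ⟨by linarith [hs.1], by linarith [hs.2]⟩
  have hs₀ : -δ < 1 / 2 := by linarith
  have ht₁ : (3 / 2 : ℝ) < (12 : ℝ) ^ 2 := by norm_num
  have hT : (3 / 2 : ℝ) - 1 / 2 ≤ 1 := by norm_num
  have hsq : Real.sqrt ((3 / 2 : ℝ) - 1 / 2) = 1 := by norm_num
  -- `M_u = K√ε₀`
  set Mu : ℝ := K * Real.sqrt ε₀ with hMu
  have hMu0 : 0 ≤ Mu := by positivity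
  have hMum : Mu ≤ m := hKε
  have hMu1 : Mu ≤ 1 := hMum.trans hm1
  have hMu2 : Mu ^ 2 ≤ Mu := by
    calc Mu ^ 2 = Mu * Mu := sq Mu
      _ ≤ Mu * 1 := mul_le_mul_of_nonneg_left hMu1 hMu0
      _ = Mu := mul_one _
  have hMub : ∀ s ∈ Icc (1 / 2 : ℝ) (3 / 2), ∀ y ∈ ball x₁ 11, ‖u s y‖ ≤ Mu := by
    intro s hs y hy
    have h := hE hε₀0 hε₀1 x₁ hδ (by norm_num : (1 : ℝ) ≤ 12) hu hp hns hdiv hu3 hp32 s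
      ⟨by linarith [hs.1], by linarith [hs.2]⟩ y (by norm_num; exact hy)
    exact h
  -- `M_p = |B̄₉|^{1/3} ε₀`
  set Mp : ℝ := Vf * ε₀ with hMp
  have hMp0 : 0 ≤ Mp := by positivity
  have hMpm : Mp ≤ m := hVε
  have hMpb : ∀ s ∈ Icc (1 / 2 : ℝ) (3 / 2), ∫ y in closedBall x₁ 9, |p s y| ≤ Mp := fun s hs =>
    integral_abs_le_of_eLpNorm_three_halves (continuousOn_pressure_slice hcyl (hI hs)) hε₀0.le (hp32 s (hI hs))
  -- the datum sizes
  set D₀ : ℝ := Mu + C_B * Mu ^ 2 * 2 with hD₀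
  have hD₀0 : 0 ≤ D₀ := by positivity
  have hD₀le : D₀ ≤ (1 + 2 * C_B) * m := by
    have h1 : C_B * Mu ^ 2 * 2 ≤ C_B * Mu * 2 :=
      mul_le_mul_of_nonneg_right (mul_le_mul_of_nonneg_left hMu2 hCB0.le) zero_le_two
    calc D₀ = Mu + C_B * Mu ^ 2 * 2 := rfl
      _ ≤ Mu + C_B * Mu * 2 := by linarith
      _ = (1 + 2 * C_B) * Mu := by ring
      _ ≤ (1 + 2 * C_B) * m := mul_le_mul_of_nonneg_left hMum (by positivity)
  set D₀' : ℝ := A * (Mu + Mu ^ 2 + Mp) with hD₀'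
  have hD₀'0 : 0 ≤ D₀' := by positivity
  have hD₀'le : D₀' ≤ 7 * ρ₀ / 8 := by
    have h1 : Mu + Mu ^ 2 + Mp ≤ 3 * m := by linarith
    calc D₀' ≤ A * (3 * m) := mul_le_mul_of_nonneg_left h1 hA0
      _ = 3 * (A + 1) * m - 3 * m := by ring
      _ ≤ 3 * (A + 1) * m := by linarith [hm0.le]
      _ ≤ 7 * ρ₀ / 8 := hmA
  -- bounds of `v` on the slab
  have hMv : ∀ s ∈ Ioo (1 / 2 : ℝ) (3 / 2), ∀ y, ‖locVelocity (cutoff12 x₁) u s y‖ ≤ Mu := fun s hs y =>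
    norm_locVelocity_le' hχ hMub (Ioo_subset_Icc_self hs) y
  have hCB1 : ∀ {u v : ℝ → EuclideanSpace ℝ (Fin 3) → EuclideanSpace ℝ (Fin 3)} {s t Mu Mv : ℝ}, s < t →
      0 ≤ Mu → 0 ≤ Mv → (∀ τ ∈ Ioo s t, ∀ y, ‖u τ y‖ ≤ Mu) → (∀ τ ∈ Ioo s t, ∀ y, ‖v τ y‖ ≤ Mv) → ∀ x,
      ‖oseenDuhamel 1 s u v t x‖ ≤ C_B * Mu * Mv * (1 : ℝ) ^ (-(1 / 2 : ℝ)) * (2 * Real.sqrt (t - s)) :=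
    fun hst hMu hMv hu hv x => hCB one_pos hst hMu hMv hu hv x
  -- the scheme datum
  have hDat : IsSchemeDatum x₁ c (1 / 2) (3 / 2) D₀ D₀' (locData x₁ 12 (cutoff12 x₁) u p (1 / 2))
      (locDataC x₁ 12 (cutoff12 x₁) u p (1 / 2)) := by
    refine ⟨aestronglyMeasurable_uncurry_locData hcyl hχ hs₀ ht₁, hD₀0, fun t ht x => ?_, hD₀'0,
      fun t ht ζ hζ => ?_, fun t ht => ?_, fun t ht x => ?_⟩
    · have h := norm_locData_le hcyl hχ hs₀ ht₁ hCB1 hMu0 hMv ht x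
      refine h.trans ?_
      have hsqt : Real.sqrt (t - 1 / 2) ≤ 1 := by rw [Real.sqrt_le_one]; linarith [ht.2]
      rw [hD₀]
      have : C_B * Mu ^ 2 * (2 * Real.sqrt (t - 1 / 2)) ≤ C_B * Mu ^ 2 * 2 := by
        have h0 : 0 ≤ C_B * Mu ^ 2 := by positivity
        calc C_B * Mu ^ 2 * (2 * Real.sqrt (t - 1 / 2)) ≤ C_B * Mu ^ 2 * (2 * 1) := by gcongr
          _ = C_B * Mu ^ 2 * 2 := by ring
      linarith
    · obtain ⟨x, y, rfl, hx, -, hyψ, hyκ, -⟩ := mem_region hζ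
      have hy1 : ‖y‖ ≤ Real.sqrt (t - 1 / 2) := by
        refine hyψ.le.trans ?_
        have hA1 : c * Real.sqrt (t - 1 / 2) ≤ Real.sqrt (t - 1 / 2) := mul_le_of_le_one_left (Real.sqrt_nonneg _) hc1
        calc c * Real.sqrt (t - 1 / 2) * bump2 x₁ x ≤ Real.sqrt (t - 1 / 2) * bump2 x₁ x :=
              mul_le_mul_of_nonneg_right hA1 (bump2_nonneg _ _)
          _ ≤ Real.sqrt (t - 1 / 2) := mul_le_of_le_one_right (Real.sqrt_nonneg _) (bump2_le_one _ _)
      have hy2 : ‖y‖ ≤ 1 := by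
        refine hyκ.le.trans ?_
        have hsqt : Real.sqrt (t - 1 / 2) ≤ 1 := by rw [Real.sqrt_le_one]; linarith [ht.2]
        calc c * Real.sqrt (t - 1 / 2) ≤ 1 * 1 := by gcongr
          _ = 1 := one_mul _
      exact hA hcyl hχ hL₁ hL₂ hI hT hMu0 hMub hMp0 hMpb ht hx hy1 hy2
    · refine differentiableOn_locDataC hcyl hχ hI hT hL₁ hMu0 hMub ht (isOpen_region _ _ _ _) fun ζ hζ => ?_
      obtain ⟨x, y, rfl, hx, -, hyψ, hyκ, -⟩ := mem_region hζ
      have hsqt : Real.sqrt (t - 1 / 2) ≤ 1 := by rw [Real.sqrt_le_one]; linarith [ht.2]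
      refine ⟨x, y, rfl, hx, hyψ.le.trans ?_, hyκ.le.trans ?_⟩
      · have hA1 : c * Real.sqrt (t - 1 / 2) ≤ Real.sqrt (t - 1 / 2) := mul_le_of_le_one_left (Real.sqrt_nonneg _) hc1
        calc c * Real.sqrt (t - 1 / 2) * bump2 x₁ x ≤ Real.sqrt (t - 1 / 2) * bump2 x₁ x :=
              mul_le_mul_of_nonneg_right hA1 (bump2_nonneg _ _)
          _ ≤ Real.sqrt (t - 1 / 2) := mul_le_of_le_one_right (Real.sqrt_nonneg _) (bump2_le_one _ _)
      · calc c * Real.sqrt (t - 1 / 2) ≤ 1 * 1 := by gcongr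
          _ = 1 := one_mul _
    · exact locDataC_complexify hcyl hχ hs₀ ht.1 (ht.2.trans ht₁) x
  -- the run of the scheme
  have hRun : IsSchemeRun x₁ c (1 / 2) (3 / 2) D₀ D₀' (locData x₁ 12 (cutoff12 x₁) u p (1 / 2))
      (locDataC x₁ 12 (cutoff12 x₁) u p (1 / 2)) C_B Cf L₀ C_H ρ₀ := by
    refine ⟨hDat, hCB0, hCB1, ?_, hCf0, hCf, hL₀0, hL₀, hLip, hCH0, hCH, by norm_num, hc0, hc1, ?_, ?_, ?_, ?_⟩
    · -- `C_B (2D₀) 2√1 ≤ 1/4`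
      rw [hsq]
      calc C_B * (2 * D₀) * (2 * 1) = 4 * C_B * D₀ := by ring
        _ ≤ 4 * C_B * ((1 + 2 * C_B) * m) := by gcongr
        _ = (16 * C_B * (1 + 2 * C_B) * m) / 4 := by ring
        _ ≤ 1 / 4 := by linarith
    · rw [hsq, mul_one]; exact hcL
    · linarith
    · rw [hsq]
      have h1 : (1 + c * 1 * L₀ * (1 + 2 * C_H)) * Cf * ρ₀ ^ 2 * (2 * 1) = 2 * (Λ * ρ₀) * ρ₀ := by rw [hΛ]; ring
      rw [h1, hΛρ]
      linarith
    · rw [hsq]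
      have h1 : (1 + c * 1 * L₀ * (1 + 2 * C_H)) * Cf * ρ₀ * (2 * 1) = 2 * (Λ * ρ₀) := by rw [hΛ]; ring
      rw [h1, hΛρ]
      norm_num
  -- the localised velocity is the bounded fixed point
  have hvm : AEStronglyMeasurable (uncurry (locVelocity (cutoff12 x₁) u))
      ((volume : Measure (ℝ × EuclideanSpace ℝ (Fin 3))).restrict (Ioo (1 / 2 : ℝ) (3 / 2) ×ˢ univ)) :=
    aestronglyMeasurable_uncurry_locVelocity hcyl hχ hI
  have hvb : ∀ t ∈ Ioo (1 / 2 : ℝ) (3 / 2), ∀ x, ‖locVelocity (cutoff12 x₁) u t x‖ ≤ 2 * D₀ := by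
    intro t ht x
    refine (hMv t ht x).trans ?_
    rw [hD₀]
    have : 0 ≤ C_B * Mu ^ 2 * 2 := by positivity
    linarith
  have hvfix : ∀ t ∈ Ioo (1 / 2 : ℝ) (3 / 2), ∀ x, locVelocity (cutoff12 x₁) u t x =
      locData x₁ 12 (cutoff12 x₁) u p (1 / 2) t x -
        oseenDuhamel 1 (1 / 2) (locVelocity (cutoff12 x₁) u) (locVelocity (cutoff12 x₁) u) t x :=
    fun t ht x => locVelocity_eq_locData_sub hcyl hχ hs₀ ht.1 (ht.2.trans ht₁) x
  obtain ⟨U, hU, hUbd, hUres⟩ := exists_differentiableOn_region_of_fixedPoint_norm_le hRun hvm hvb hvfix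
    (t := 1) (by norm_num)
  -- conclusion on the local tube over `B(x₁, 1)`
  have htube : localComplexTube x₁ 1 (1 / (4 * C₀)) ⊆ region x₁ c (1 / 2) 1 := by
    rw [hC₀κ]
    exact localComplexTube_subset_profileRegion x₁ κ
  refine ⟨U, hU.mono htube, fun z hz => hUbd z (htube hz), fun x hx => ?_⟩
  have hxreg : complexify x ∈ region x₁ c (1 / 2) 1 := by
    show complexify x ∈ profileRegion fun z => (c * Real.sqrt (1 - 1 / 2)) * bump2 x₁ z
    rw [complexify_mem_profileRegion_iff, bump2_eq_one_of_mem (ball_subset_closedBall hx), mul_one]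
    exact hκ0
  rw [hUres x hxreg, locVelocity_apply, hχ.eq_one x ?_, one_smul]
  norm_num
  exact (closedBall_subset_closedBall (by norm_num)) (ball_subset_closedBall hx)



/-! ### Transport of the bound: rescaling, gluing over unit balls, over heights -/

/-- **Bounded transport of the extension under the rescaling** (twin of
`exists_extension_of_rescaled`): if the slice of the rescaled field `y ↦ c·g(x_c + c y)` on
`B(0, r/c)` extends to the local region of height `h` with bound `K`, then `g` extends from
`B(x_c, r)` to the region of height `c h` with bound `K/c` — the extension being
`z ↦ c⁻¹ U'(c⁻¹(z − x_c))` (the scaling covariance of BGK's statement and of the bound of its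
scheme). [cite: BradshawGrujicKukavica2015, Thm. 2.3 (scaling covariance of the statement) and (4.9)] -/
theorem exists_extension_of_rescaled_norm_le {xc : EuclideanSpace ℝ (Fin 3)} {c r h K : ℝ}
    (hc : 0 < c) {g : EuclideanSpace ℝ (Fin 3) → EuclideanSpace ℝ (Fin 3)}
    {U' : EuclideanSpace ℂ (Fin 3) → EuclideanSpace ℂ (Fin 3)}
    (hU' : DifferentiableOn ℂ U' (localComplexTube 0 (r / c) h))
    (hU'b : ∀ ζ ∈ localComplexTube 0 (r / c) h, ‖U' ζ‖ ≤ K)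
    (hU'g : ∀ y ∈ ball (0 : EuclideanSpace ℝ (Fin 3)) (r / c),
      U' (complexify y) = complexify (c • g (xc + c • y))) :
    ∃ U : EuclideanSpace ℂ (Fin 3) → EuclideanSpace ℂ (Fin 3),
      DifferentiableOn ℂ U (localComplexTube xc r (c * h)) ∧
      (∀ z ∈ localComplexTube xc r (c * h), ‖U z‖ ≤ K / c) ∧
      ∀ x ∈ ball xc r, U (complexify x) = complexify (g x) := by
  set A : EuclideanSpace ℂ (Fin 3) → EuclideanSpace ℂ (Fin 3) :=
    fun z => (c⁻¹ : ℝ) • (z - complexify xc) with hA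
  have hAd : Differentiable ℂ A := fun z =>
    ((differentiableAt_id.sub (differentiableAt_const _)).const_smul (c⁻¹ : ℝ))
  refine ⟨fun z => (c⁻¹ : ℝ) • U' (A z), ?_, fun z hz => ?_, fun x hx => ?_⟩
  · exact ((hU'.comp hAd.differentiableOn (mapsTo_rescale_localComplexTube hc)).const_smul
      (c⁻¹ : ℝ))
  · have hAz : A z ∈ localComplexTube 0 (r / c) h := mapsTo_rescale_localComplexTube hc hz
    show ‖(c⁻¹ : ℝ) • U' (A z)‖ ≤ K / c
    rw [norm_smul, Real.norm_eq_abs, abs_of_pos (inv_pos.2 hc), div_eq_inv_mul]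
    exact mul_le_mul_of_nonneg_left (hU'b _ hAz) (inv_pos.2 hc).le
  · have hy : c⁻¹ • (x - xc) ∈ ball (0 : EuclideanSpace ℝ (Fin 3)) (r / c) := by
      rw [mem_ball, dist_zero_right, norm_smul, Real.norm_eq_abs, abs_of_pos (inv_pos.2 hc),
        ← dist_eq_norm, lt_div_iff₀ hc]
      calc c⁻¹ * dist x xc * c = dist x xc := by field_simp
        _ < r := hx
    have hAx : A (complexify x) = complexify (c⁻¹ • (x - xc)) := by
      simp only [hA, LinearIsometry.map_smul, map_sub]
    have hxx : xc + c • (c⁻¹ • (x - xc)) = x := by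
      rw [smul_smul, mul_inv_cancel₀ hc.ne', one_smul, add_sub_cancel]
    show (c⁻¹ : ℝ) • U' (A (complexify x)) = complexify (g x)
    rw [hAx, hU'g _ hy, hxx, ← LinearIsometry.map_smul, smul_smul, inv_mul_cancel₀ hc.ne',
      one_smul]

/-- **Bounded gluing over a ball** (twin of `exists_differentiableOn_localComplexTube_of_forall_unit_ball`):
if above every unit ball `B(x₁, 1)` with centre in `B(x_c, R)` the map `f` has a holomorphic
extension to the local region of height `h` bounded by `K`, then its extension to
`localComplexTube x_c R h` is bounded by `K` (identity principle from the real ball,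
`eqOn_localComplexTube_of_forall_complexify_eq`; BGK identify the limit extensions through their
common real restriction). [cite: BradshawGrujicKukavica2015, proof of Thm. 2.1 (p. 16) and (4.9)] -/
theorem exists_differentiableOn_localComplexTube_of_forall_unit_ball_norm_le
    {xc : EuclideanSpace ℝ (Fin 3)} {R h K : ℝ}
    {f : EuclideanSpace ℝ (Fin 3) → EuclideanSpace ℝ (Fin 3)}
    (H : ∀ x₁ ∈ ball xc R, ∃ U : EuclideanSpace ℂ (Fin 3) → EuclideanSpace ℂ (Fin 3),
      DifferentiableOn ℂ U (localComplexTube x₁ 1 h) ∧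
      (∀ z ∈ localComplexTube x₁ 1 h, ‖U z‖ ≤ K) ∧
      ∀ x ∈ ball x₁ 1, U (complexify x) = complexify (f x)) :
    ∃ U : EuclideanSpace ℂ (Fin 3) → EuclideanSpace ℂ (Fin 3),
      DifferentiableOn ℂ U (localComplexTube xc R h) ∧
      (∀ z ∈ localComplexTube xc R h, ‖U z‖ ≤ K) ∧
      ∀ x ∈ ball xc R, U (complexify x) = complexify (f x) := by
  obtain ⟨U, hUd, hUf⟩ := exists_differentiableOn_localComplexTube_of_forall_unit_ball
    fun x₁ hx₁ => (H x₁ hx₁).imp fun U hU => ⟨hU.1, hU.2.2⟩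
  refine ⟨U, hUd, ?_, hUf⟩
  rintro z ⟨x, y, hx, hy, rfl⟩
  obtain ⟨U₁, hU₁d, hU₁b, hU₁f⟩ := H x hx
  set ρ' : ℝ := min 1 (R - dist x xc) with hρ'
  have hρ'0 : 0 < ρ' := lt_min one_pos (by linarith)
  have hb₁ : ball x ρ' ⊆ ball xc R := fun v hv => by
    rw [mem_ball] at hv ⊢
    have h1 : ρ' ≤ R - dist x xc := min_le_right _ _
    linarith [dist_triangle v x xc]
  have hb₂ : ball x ρ' ⊆ ball x 1 := ball_subset_ball (min_le_left _ _)
  have heq : EqOn U U₁ (localComplexTube x ρ' h) :=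
    eqOn_localComplexTube_of_forall_complexify_eq
      (hUd.mono (localComplexTube_subset_of_ball_subset hb₁))
      (hU₁d.mono (localComplexTube_subset_of_ball_subset hb₂))
      fun v hv => by rw [hUf v (hb₁ hv), hU₁f v (hb₂ hv)]
  have hz' : complexify x + Complex.I • complexify y ∈ localComplexTube x ρ' h :=
    ⟨x, y, by simpa using hρ'0, hy, rfl⟩
  rw [heq hz']
  exact hU₁b _ ⟨x, y, by simp, hy, rfl⟩

/-! ### The bounded core at scale `√t` from the bounded unit core -/

/-- **Bounded twin of `bgk_core_of_core_unit`**: if every smooth solution as in the fact, centred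
at `0`, whose window contains `1`, has its slice `u(1)` extendable from `B(0, r)` to the local
region of height `1/(4C₀)` WITH BOUND `K`, then at every time `t` of the window, about any centre,
the slice `u(t)` extends to height `√t/(4C₀)` with bound `K/√t` (apply the hypothesis to
`v(s,y) = √t u(ts, x_c + √t y)` and transport back with `exists_extension_of_rescaled_norm_le`).
[cite: BradshawGrujicKukavica2015, Thm. 2.3 (scaling covariance), (4.9)] -/
theorem bgk_core_of_core_unit_norm_le {C₀ C K : ℝ} (hC : 0 < C)
    (hunit : ∀ ⦃rc T₀ q r δ : ℝ⦄, 0 < rc → 0 < T₀ → 3 < q → 2 * q / (q - 3) < r → 0 < δ →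
      ∀ ⦃u : ℝ → EuclideanSpace ℝ (Fin 3) → EuclideanSpace ℝ (Fin 3)⦄
        ⦃p : ℝ → EuclideanSpace ℝ (Fin 3) → ℝ⦄,
        ContDiffOn ℝ ∞ (uncurry u) (Ioo (-δ) T₀ ×ˢ ball 0 (4 * rc)) →
        ContDiffOn ℝ ∞ (uncurry p) (Ioo (-δ) T₀ ×ˢ ball 0 (4 * rc)) →
        (∀ t ∈ Ioo (-δ) T₀, ∀ x ∈ ball 0 (4 * rc),
          deriv (fun s => u s x) t + convect (u t) (u t) x = Δ (u t) x - gradient (p t) x) →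
        (∀ t ∈ Ioo (-δ) T₀, ∀ x ∈ ball 0 (4 * rc), VectorCalculus.divergence (u t) x = 0) →
        ∀ ⦃A B D : ℝ⦄, 0 ≤ A → 0 ≤ B → 0 ≤ D →
        (∀ t ∈ Ioo (-δ) T₀, eLpNorm (u t) (ENNReal.ofReal q)
            (volume.restrict (ball 0 (4 * rc))) ≤ ENNReal.ofReal A) →
        (∀ t ∈ Ioo (-δ) T₀, eLpNorm (p t) (ENNReal.ofReal (q / 2))
            (volume.restrict (ball 0 (4 * rc))) ≤ ENNReal.ofReal (B ^ 2)) →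
        (∫⁻ t in Ioo (-δ) T₀, eLpNorm (fun x => Real.sqrt (frobeniusNormSq (fderiv ℝ (u t) x)))
            (ENNReal.ofReal q) (volume.restrict (ball 0 (4 * rc))) ^ r ≤
          ENNReal.ofReal (D ^ r)) →
      1 < C⁻¹ * min (min T₀ (rc ^ 2))
        (q ^ 2 * (C * (A + B + T₀ ^ ((r - 2) / (2 * r)) * D)) ^ (2 * q / (q - 3)))⁻¹ →
      ∃ U : EuclideanSpace ℂ (Fin 3) → EuclideanSpace ℂ (Fin 3),
        DifferentiableOn ℂ U (localComplexTube 0 rc (1 / (4 * C₀))) ∧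
        (∀ z ∈ localComplexTube 0 rc (1 / (4 * C₀)), ‖U z‖ ≤ K) ∧
        ∀ x ∈ ball (0 : EuclideanSpace ℝ (Fin 3)) rc, U (complexify x) = complexify (u 1 x))
    (xc : EuclideanSpace ℝ (Fin 3)) ⦃rc T₀ q r δ : ℝ⦄ (hrc : 0 < rc) (hT₀ : 0 < T₀) (hq : 3 < q)
    (hr : 2 * q / (q - 3) < r) (hδ : 0 < δ)
    ⦃u : ℝ → EuclideanSpace ℝ (Fin 3) → EuclideanSpace ℝ (Fin 3)⦄
    ⦃p : ℝ → EuclideanSpace ℝ (Fin 3) → ℝ⦄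
    (hu : ContDiffOn ℝ ∞ (uncurry u) (Ioo (-δ) T₀ ×ˢ ball xc (4 * rc)))
    (hp : ContDiffOn ℝ ∞ (uncurry p) (Ioo (-δ) T₀ ×ˢ ball xc (4 * rc)))
    (hns : ∀ t ∈ Ioo (-δ) T₀, ∀ x ∈ ball xc (4 * rc),
      deriv (fun s => u s x) t + convect (u t) (u t) x = Δ (u t) x - gradient (p t) x)
    (hdiv : ∀ t ∈ Ioo (-δ) T₀, ∀ x ∈ ball xc (4 * rc), VectorCalculus.divergence (u t) x = 0)
    ⦃A B D : ℝ⦄ (hA : 0 ≤ A) (hB : 0 ≤ B) (hD : 0 ≤ D)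
    (huA : ∀ t ∈ Ioo (-δ) T₀, eLpNorm (u t) (ENNReal.ofReal q)
      (volume.restrict (ball xc (4 * rc))) ≤ ENNReal.ofReal A)
    (hpB : ∀ t ∈ Ioo (-δ) T₀, eLpNorm (p t) (ENNReal.ofReal (q / 2))
      (volume.restrict (ball xc (4 * rc))) ≤ ENNReal.ofReal (B ^ 2))
    (hgrad : ∫⁻ t in Ioo (-δ) T₀, eLpNorm (fun x => Real.sqrt (frobeniusNormSq (fderiv ℝ (u t) x)))
      (ENNReal.ofReal q) (volume.restrict (ball xc (4 * rc))) ^ r ≤ ENNReal.ofReal (D ^ r))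
    ⦃t : ℝ⦄ (ht : t ∈ Ioo 0 (C⁻¹ * min (min T₀ (rc ^ 2))
      (q ^ 2 * (C * (A + B + T₀ ^ ((r - 2) / (2 * r)) * D)) ^ (2 * q / (q - 3)))⁻¹)) :
    ∃ U : EuclideanSpace ℂ (Fin 3) → EuclideanSpace ℂ (Fin 3),
      DifferentiableOn ℂ U (localComplexTube xc rc (Real.sqrt t / (4 * C₀))) ∧
      (∀ z ∈ localComplexTube xc rc (Real.sqrt t / (4 * C₀)), ‖U z‖ ≤ K / Real.sqrt t) ∧
      ∀ x ∈ ball xc rc, U (complexify x) = complexify (u t x) := by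
  have hq0 : 0 < q := by linarith
  have hr0 : 0 < r := by
    have h1 : (0 : ℝ) < 2 * q / (q - 3) := div_pos (by linarith) (by linarith)
    exact h1.trans hr
  -- the scale `c = √t`
  set c : ℝ := Real.sqrt t with hcdef
  have hc : 0 < c := Real.sqrt_pos.2 ht.1
  have hct : c ^ 2 = t := Real.sq_sqrt ht.1.le
  -- the rescaled pair and its data
  obtain ⟨hv, hπ, hns', hdiv'⟩ := bgk_rescaled_hypotheses (δ := δ) (T₀ := T₀) hc hu hp hns hdiv
  have hrc' : 0 < rc / c := div_pos hrc hc
  have hT₀' : 0 < T₀ / c ^ 2 := div_pos hT₀ (by positivity)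
  have hδ' : 0 < δ / c ^ 2 := div_pos hδ (by positivity)
  have hshift : ∀ s ∈ Ioo (-(δ / c ^ 2)) (T₀ / c ^ 2), c ^ 2 * s ∈ Ioo (-δ) T₀ := by
    intro s hs
    have hc2 : 0 < c ^ 2 := by positivity
    constructor
    · have := mul_lt_mul_of_pos_left hs.1 hc2
      rwa [mul_neg, mul_div_cancel₀ _ hc2.ne'] at this
    · have := mul_lt_mul_of_pos_left hs.2 hc2
      rwa [mul_div_cancel₀ _ hc2.ne'] at this
  have hA' : 0 ≤ c ^ (1 - 3 / q) * A := mul_nonneg (Real.rpow_nonneg hc.le _) hA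
  have hB' : 0 ≤ c ^ (1 - 3 / q) * B := mul_nonneg (Real.rpow_nonneg hc.le _) hB
  have hD' : 0 ≤ c ^ (2 - 3 / q - 2 / r) * D := mul_nonneg (Real.rpow_nonneg hc.le _) hD
  have huA' : ∀ s ∈ Ioo (-(δ / c ^ 2)) (T₀ / c ^ 2),
      eLpNorm ((c • stPull (c ^ 2) c 0 xc u) s) (ENNReal.ofReal q)
        (volume.restrict (ball (0 : EuclideanSpace ℝ (Fin 3)) (4 * (rc / c)))) ≤
      ENNReal.ofReal (c ^ (1 - 3 / q) * A) :=
    fun s hs => bgk_rescaled_Lq_bound hc hq0 (huA _ (hshift s hs))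
  have hpB' : ∀ s ∈ Ioo (-(δ / c ^ 2)) (T₀ / c ^ 2),
      eLpNorm ((c ^ 2 • stPull (c ^ 2) c 0 xc p) s) (ENNReal.ofReal (q / 2))
        (volume.restrict (ball (0 : EuclideanSpace ℝ (Fin 3)) (4 * (rc / c)))) ≤
      ENNReal.ofReal ((c ^ (1 - 3 / q) * B) ^ 2) :=
    fun s hs => bgk_rescaled_pressure_bound hc hq0 (hpB _ (hshift s hs))
  have hgrad' := bgk_rescaled_gradient_bound (xc := xc) (rc := rc) (T₀ := T₀) (δ := δ)
    hc hq0 hr0 hD hgrad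
  -- the window of the rescaled data contains `1`
  have hM : 0 ≤ A + B + T₀ ^ ((r - 2) / (2 * r)) * D := by positivity
  have hwin : 1 < C⁻¹ * min (min (T₀ / c ^ 2) ((rc / c) ^ 2))
      (q ^ 2 * (C * (c ^ (1 - 3 / q) * A + c ^ (1 - 3 / q) * B +
        (T₀ / c ^ 2) ^ ((r - 2) / (2 * r)) * (c ^ (2 - 3 / q - 2 / r) * D))) ^
          (2 * q / (q - 3)))⁻¹ := by
    rw [bgk_local_quantity_rescale hc hT₀ hr0.ne', bgk_window_rescale hc hC hM hq, hct,
      lt_div_iff₀ ht.1, one_mul]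
    exact ht.2
  obtain ⟨U', hU'd, hU'b, hU'f⟩ := hunit hrc' hT₀' hq hr hδ' hv hπ hns' hdiv' hA' hB' hD' huA'
    hpB' hgrad' hwin
  -- transport back
  have hheight : Real.sqrt t / (4 * C₀) = c * (1 / (4 * C₀)) := by
    rw [hcdef]; ring
  rw [hheight]
  refine exists_extension_of_rescaled_norm_le hc hU'd hU'b fun y hy => ?_
  rw [hU'f y hy]
  simp [stPull_apply, hct]

/-! ### The bounded statement from a bounded core smooth across the initial time -/

/-- **Bounded twin of `bradshawGrujicKukavica2015_local_analyticity_radius_of_core`** (reduction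
to solutions smooth across the initial time): if the bounded conclusion — extension to height
`√t/(4C₀)` with sup bound `K/√t` — holds for all smooth solutions on cylinders `(−δ, T₀) × 4B_*`,
then it holds, with bound `2K/√t`, for the solutions of the fact on `(0, T₀) × 4B_*`: the
extension is glued over `ε ↓ 0` from those of the translates `s ↦ u(s + ε)` (heights
`√(t−ε)/(4C₀)`), and at a point of imaginary height `< √t/(4C₀)` it coincides, by the identity
principle from the real ball, with the extension of a translate with `t − ε > t/4`, bounded by
`K/√(t−ε) ≤ 2K/√t`. [cite: BradshawGrujicKukavica2015, Thm. 2.3 and §4] -/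
theorem bgk_supBound_of_core {C₀ C K : ℝ} (hC₀ : 0 < C₀) (hC : 1 ≤ C) (hK : 0 ≤ K)
    (hcore : ∀ (xc : EuclideanSpace ℝ (Fin 3)) ⦃rc T₀ q r δ : ℝ⦄, 0 < rc → 0 < T₀ → 3 < q →
      2 * q / (q - 3) < r → 0 < δ →
      ∀ ⦃u : ℝ → EuclideanSpace ℝ (Fin 3) → EuclideanSpace ℝ (Fin 3)⦄
        ⦃p : ℝ → EuclideanSpace ℝ (Fin 3) → ℝ⦄,
        ContDiffOn ℝ ∞ (uncurry u) (Ioo (-δ) T₀ ×ˢ ball xc (4 * rc)) →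
        ContDiffOn ℝ ∞ (uncurry p) (Ioo (-δ) T₀ ×ˢ ball xc (4 * rc)) →
        (∀ t ∈ Ioo (-δ) T₀, ∀ x ∈ ball xc (4 * rc),
          deriv (fun s => u s x) t + convect (u t) (u t) x = Δ (u t) x - gradient (p t) x) →
        (∀ t ∈ Ioo (-δ) T₀, ∀ x ∈ ball xc (4 * rc), VectorCalculus.divergence (u t) x = 0) →
        ∀ ⦃A B D : ℝ⦄, 0 ≤ A → 0 ≤ B → 0 ≤ D →
        (∀ t ∈ Ioo (-δ) T₀, eLpNorm (u t) (ENNReal.ofReal q)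
            (volume.restrict (ball xc (4 * rc))) ≤ ENNReal.ofReal A) →
        (∀ t ∈ Ioo (-δ) T₀, eLpNorm (p t) (ENNReal.ofReal (q / 2))
            (volume.restrict (ball xc (4 * rc))) ≤ ENNReal.ofReal (B ^ 2)) →
        (∫⁻ t in Ioo (-δ) T₀, eLpNorm (fun x => Real.sqrt (frobeniusNormSq (fderiv ℝ (u t) x)))
            (ENNReal.ofReal q) (volume.restrict (ball xc (4 * rc))) ^ r ≤
          ENNReal.ofReal (D ^ r)) →
        ∀ t ∈ Ioo 0 (C⁻¹ * min (min T₀ (rc ^ 2))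
            (q ^ 2 * (C * (A + B + T₀ ^ ((r - 2) / (2 * r)) * D)) ^ (2 * q / (q - 3)))⁻¹),
          ∃ U : EuclideanSpace ℂ (Fin 3) → EuclideanSpace ℂ (Fin 3),
            DifferentiableOn ℂ U (localComplexTube xc rc (Real.sqrt t / (4 * C₀))) ∧
            (∀ z ∈ localComplexTube xc rc (Real.sqrt t / (4 * C₀)), ‖U z‖ ≤ K / Real.sqrt t) ∧
            ∀ x ∈ ball xc rc, U (complexify x) = complexify (u t x))
    (xc : EuclideanSpace ℝ (Fin 3)) ⦃rc T₀ q r : ℝ⦄ (hrc : 0 < rc) (hq : 3 < q)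
    (hr : 2 * q / (q - 3) < r)
    ⦃u : ℝ → EuclideanSpace ℝ (Fin 3) → EuclideanSpace ℝ (Fin 3)⦄
    ⦃p : ℝ → EuclideanSpace ℝ (Fin 3) → ℝ⦄
    (hu : ContDiffOn ℝ ∞ (uncurry u) (Ioo 0 T₀ ×ˢ ball xc (4 * rc)))
    (hp : ContDiffOn ℝ ∞ (uncurry p) (Ioo 0 T₀ ×ˢ ball xc (4 * rc)))
    (hns : ∀ t ∈ Ioo 0 T₀, ∀ x ∈ ball xc (4 * rc),
      deriv (fun s => u s x) t + convect (u t) (u t) x = Δ (u t) x - gradient (p t) x)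
    (hdiv : ∀ t ∈ Ioo 0 T₀, ∀ x ∈ ball xc (4 * rc), VectorCalculus.divergence (u t) x = 0)
    ⦃A B D : ℝ⦄ (hA : 0 ≤ A) (hB : 0 ≤ B) (hD : 0 ≤ D)
    (huA : ∀ t ∈ Ioo 0 T₀, eLpNorm (u t) (ENNReal.ofReal q)
      (volume.restrict (ball xc (4 * rc))) ≤ ENNReal.ofReal A)
    (hpB : ∀ t ∈ Ioo 0 T₀, eLpNorm (p t) (ENNReal.ofReal (q / 2))
      (volume.restrict (ball xc (4 * rc))) ≤ ENNReal.ofReal (B ^ 2))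
    (hgrad : ∫⁻ t in Ioo 0 T₀, eLpNorm (fun x => Real.sqrt (frobeniusNormSq (fderiv ℝ (u t) x)))
      (ENNReal.ofReal q) (volume.restrict (ball xc (4 * rc))) ^ r ≤ ENNReal.ofReal (D ^ r))
    ⦃t : ℝ⦄ (ht : t ∈ Ioo 0 (C⁻¹ * min (min T₀ (rc ^ 2))
      (q ^ 2 * (C * (A + B + T₀ ^ ((r - 2) / (2 * r)) * D)) ^ (2 * q / (q - 3)))⁻¹)) :
    ∃ U : EuclideanSpace ℂ (Fin 3) → EuclideanSpace ℂ (Fin 3),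
      DifferentiableOn ℂ U (localComplexTube xc rc (Real.sqrt t / (4 * C₀))) ∧
      (∀ z ∈ localComplexTube xc rc (Real.sqrt t / (4 * C₀)), ‖U z‖ ≤ 2 * K / Real.sqrt t) ∧
      ∀ x ∈ ball xc rc, U (complexify x) = complexify (u t x) := by
  have ht0 : 0 < t := ht.1
  have htT₀ : t < T₀ := bgk_lt_T₀_of_mem_window hC ht0 ht.2
  -- the bounded extensions of the translates `s ↦ u(s + ε)`, `0 < ε < t`, at time `t - ε`
  have hshifted : ∀ ε : ℝ, 0 < ε → ε < t →
      ∃ U : EuclideanSpace ℂ (Fin 3) → EuclideanSpace ℂ (Fin 3),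
        DifferentiableOn ℂ U (localComplexTube xc rc (Real.sqrt (t - ε) / (4 * C₀))) ∧
        (∀ z ∈ localComplexTube xc rc (Real.sqrt (t - ε) / (4 * C₀)),
          ‖U z‖ ≤ K / Real.sqrt (t - ε)) ∧
        ∀ x ∈ ball xc rc, U (complexify x) = complexify (u t x) := by
    intro ε hε0 hεt
    -- the translated solution on `(-ε, T₀ - ε) × 4B`
    have hT₀' : 0 < T₀ - ε := by linarith
    have hshift : ∀ s' ∈ Ioo (-ε) (T₀ - ε), s' + ε ∈ Ioo 0 T₀ := fun s' hs' =>
      ⟨by linarith [hs'.1], by linarith [hs'.2]⟩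
    have hmaps : MapsTo (fun z : ℝ × EuclideanSpace ℝ (Fin 3) => (z.1 + ε, z.2))
        (Ioo (-ε) (T₀ - ε) ×ˢ ball xc (4 * rc)) (Ioo 0 T₀ ×ˢ ball xc (4 * rc)) :=
      fun z hz => ⟨hshift z.1 hz.1, hz.2⟩
    have haff : ContDiff ℝ ∞ (fun z : ℝ × EuclideanSpace ℝ (Fin 3) => (z.1 + ε, z.2)) :=
      (contDiff_fst.add contDiff_const).prodMk contDiff_snd
    have hu'c : ContDiffOn ℝ ∞ (uncurry fun s' => u (s' + ε))
        (Ioo (-ε) (T₀ - ε) ×ˢ ball xc (4 * rc)) :=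
      hu.comp haff.contDiffOn hmaps
    have hp'c : ContDiffOn ℝ ∞ (uncurry fun s' => p (s' + ε))
        (Ioo (-ε) (T₀ - ε) ×ˢ ball xc (4 * rc)) :=
      hp.comp haff.contDiffOn hmaps
    have hns' : ∀ s' ∈ Ioo (-ε) (T₀ - ε), ∀ x ∈ ball xc (4 * rc),
        deriv (fun σ => u (σ + ε) x) s' + convect (u (s' + ε)) (u (s' + ε)) x =
          Δ (u (s' + ε)) x - gradient (p (s' + ε)) x := by
      intro s' hs' x hx
      rw [deriv_comp_add_const (fun σ => u σ x) ε s']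
      exact hns (s' + ε) (hshift s' hs') x hx
    have hdiv' : ∀ s' ∈ Ioo (-ε) (T₀ - ε), ∀ x ∈ ball xc (4 * rc),
        VectorCalculus.divergence (u (s' + ε)) x = 0 :=
      fun s' hs' x hx => hdiv (s' + ε) (hshift s' hs') x hx
    have huA' : ∀ s' ∈ Ioo (-ε) (T₀ - ε), eLpNorm (u (s' + ε)) (ENNReal.ofReal q)
        (volume.restrict (ball xc (4 * rc))) ≤ ENNReal.ofReal A :=
      fun s' hs' => huA (s' + ε) (hshift s' hs')
    have hpB' : ∀ s' ∈ Ioo (-ε) (T₀ - ε), eLpNorm (p (s' + ε)) (ENNReal.ofReal (q / 2))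
        (volume.restrict (ball xc (4 * rc))) ≤ ENNReal.ofReal (B ^ 2) :=
      fun s' hs' => hpB (s' + ε) (hshift s' hs')
    have hgrad' : ∫⁻ s' in Ioo (-ε) (T₀ - ε),
        eLpNorm (fun x => Real.sqrt (frobeniusNormSq (fderiv ℝ (u (s' + ε)) x))) (ENNReal.ofReal q)
          (volume.restrict (ball xc (4 * rc))) ^ r ≤ ENNReal.ofReal (D ^ r) := by
      rw [lintegral_Ioo_neg_sub_comp_add_right (fun τ => eLpNorm
        (fun x => Real.sqrt (frobeniusNormSq (fderiv ℝ (u τ) x))) (ENNReal.ofReal q)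
          (volume.restrict (ball xc (4 * rc))) ^ r) ε T₀]
      exact hgrad
    -- the window of the translated solution contains `t - ε`
    have hwin' := bgk_window_shift (rc := rc) hC hq hr hT₀' (by linarith) hA hB hD ht.2
    have hTT : T₀ - (T₀ - ε) = ε := by ring
    rw [hTT] at hwin'
    obtain ⟨U, hUd, hUb, hUf⟩ := hcore xc hrc hT₀' hq hr hε0 hu'c hp'c hns' hdiv' hA hB hD huA'
      hpB' hgrad' (t - ε) ⟨by linarith, hwin'⟩
    exact ⟨U, hUd, hUb, fun x hx => by rw [hUf x hx, sub_add_cancel]⟩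
  -- the extension to the full height, glued over `ε ↓ 0`
  obtain ⟨U, hUd, hUf⟩ := exists_differentiableOn_localComplexTube_of_forall_lt
    (x₀ := xc) (ρ := rc) (h := Real.sqrt t / (4 * C₀)) (f := u t) fun h' hh' => by
      obtain ⟨ε, hε0, hεt, hheight⟩ := exists_pos_lt_height_sqrt_sub hC₀ ht0 hh'
      obtain ⟨U, hUd, -, hUf⟩ := hshifted ε hε0 hεt
      exact ⟨U, hUd.mono (localComplexTube_mono le_rfl hheight.le), hUf⟩
  refine ⟨U, hUd, ?_, hUf⟩
  -- the bound at a point: compare with the extension of a translate with `t - ε > t/4`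
  rintro z ⟨x, y, hx, hy, rfl⟩
  have h4 : 0 < 4 * C₀ := by positivity
  set h' : ℝ := max ‖y‖ (Real.sqrt t / 2 / (4 * C₀)) with hh'
  have hh'lt : h' < Real.sqrt t / (4 * C₀) := by
    refine max_lt hy ?_
    rw [div_lt_div_iff_of_pos_right h4]
    linarith [Real.sqrt_pos.2 ht0]
  obtain ⟨ε, hε0, hεt, hheight⟩ := exists_pos_lt_height_sqrt_sub hC₀ ht0 hh'lt
  obtain ⟨Uε, hUεd, hUεb, hUεf⟩ := hshifted ε hε0 hεt
  have hle : Real.sqrt (t - ε) / (4 * C₀) ≤ Real.sqrt t / (4 * C₀) :=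
    div_le_div_of_nonneg_right (Real.sqrt_le_sqrt (by linarith)) h4.le
  have heq : EqOn U Uε (localComplexTube xc rc (Real.sqrt (t - ε) / (4 * C₀))) :=
    eqOn_localComplexTube_of_forall_complexify_eq (hUd.mono (localComplexTube_mono le_rfl hle))
      hUεd fun v hv => by rw [hUf v hv, hUεf v hv]
  have hzε : complexify x + Complex.I • complexify y ∈
      localComplexTube xc rc (Real.sqrt (t - ε) / (4 * C₀)) :=
    ⟨x, y, hx, (le_max_left _ _).trans_lt (hh' ▸ hheight), rfl⟩
  rw [heq hzε]
  refine (hUεb _ hzε).trans ?_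
  -- `K/√(t-ε) ≤ 2K/√t` since `√t/2 < √(t-ε)`
  have hs2 : Real.sqrt t / 2 < Real.sqrt (t - ε) := by
    have h1 : Real.sqrt t / 2 / (4 * C₀) < Real.sqrt (t - ε) / (4 * C₀) :=
      (le_max_right _ _).trans_lt (hh' ▸ hheight)
    rwa [div_lt_div_iff_of_pos_right h4] at h1
  have hsε : 0 < Real.sqrt (t - ε) := Real.sqrt_pos.2 (by linarith)
  rw [div_le_div_iff₀ hsε (Real.sqrt_pos.2 ht0)]
  nlinarith [Real.sqrt_nonneg t]

/-! ### The bounded statement from the bounded small-data unit-scale core -/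

/-- **Bounded twin of `bradshawGrujicKukavica2015_local_analyticity_radius_of_small`**: from the
`q`-free small-data unit-scale core WITH BOUND `K` (aspect `R ≥ 2`, smallness `ε₀`, height
`1/(4C₀)`) follows the statement of the fact with the same `C₀`, an explicit window constant `C`,
and the sup bound `2K/√t` of the extension on `Ω_*(t)` (the proof of `…_of_small` verbatim —
Hölder on balls of radius `R`, the cover of `B_*` by unit balls — with the bounded gluing
`exists_differentiableOn_localComplexTube_of_forall_unit_ball_norm_le`, the bounded rescaling
`bgk_core_of_core_unit_norm_le` and the bounded reduction `bgk_supBound_of_core`).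
[cite: BradshawGrujicKukavica2015, Thm. 2.3 and §4, (4.9)] -/
theorem bgk_supBound_of_small {R ε₀ C₀ K : ℝ}
    (hR : 2 ≤ R) (hε₀ : 0 < ε₀) (hC₀ : 0 < C₀) (hK : 0 ≤ K)
    (hsmall : ∀ (x₁ : EuclideanSpace ℝ (Fin 3)) ⦃δ : ℝ⦄, 0 < δ →
      ∀ ⦃u : ℝ → EuclideanSpace ℝ (Fin 3) → EuclideanSpace ℝ (Fin 3)⦄
        ⦃p : ℝ → EuclideanSpace ℝ (Fin 3) → ℝ⦄,
        ContDiffOn ℝ ∞ (uncurry u) (Ioo (-δ) (R ^ 2) ×ˢ ball x₁ R) →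
        ContDiffOn ℝ ∞ (uncurry p) (Ioo (-δ) (R ^ 2) ×ˢ ball x₁ R) →
        (∀ t ∈ Ioo (-δ) (R ^ 2), ∀ x ∈ ball x₁ R,
          deriv (fun s => u s x) t + convect (u t) (u t) x = Δ (u t) x - gradient (p t) x) →
        (∀ t ∈ Ioo (-δ) (R ^ 2), ∀ x ∈ ball x₁ R, VectorCalculus.divergence (u t) x = 0) →
        (∀ t ∈ Ioo (-δ) (R ^ 2),
          eLpNorm (u t) 3 (volume.restrict (ball x₁ R)) ≤ ENNReal.ofReal ε₀) →
        (∀ t ∈ Ioo (-δ) (R ^ 2),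
          eLpNorm (p t) (ENNReal.ofReal (3 / 2)) (volume.restrict (ball x₁ R)) ≤
            ENNReal.ofReal ε₀) →
        (∫⁻ t in Ioo 0 (R ^ 2),
          eLpNorm (fun x => Real.sqrt (frobeniusNormSq (fderiv ℝ (u t) x))) 2
            (volume.restrict (ball x₁ R)) ^ (2 : ℝ) ≤ ENNReal.ofReal (ε₀ ^ 2)) →
        ∃ U : EuclideanSpace ℂ (Fin 3) → EuclideanSpace ℂ (Fin 3),
          DifferentiableOn ℂ U (localComplexTube x₁ 1 (1 / (4 * C₀))) ∧
          (∀ z ∈ localComplexTube x₁ 1 (1 / (4 * C₀)), ‖U z‖ ≤ K) ∧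
          ∀ x ∈ ball x₁ 1, U (complexify x) = complexify (u 1 x)) :
    ∃ C : ℝ, 0 < C ∧
    ∀ (xc : EuclideanSpace ℝ (Fin 3)) ⦃rc T₀ q r : ℝ⦄, 0 < rc → 0 < T₀ → 3 < q →
      2 * q / (q - 3) < r →
    ∀ ⦃u : ℝ → EuclideanSpace ℝ (Fin 3) → EuclideanSpace ℝ (Fin 3)⦄
      ⦃p : ℝ → EuclideanSpace ℝ (Fin 3) → ℝ⦄,
      ContDiffOn ℝ ∞ (uncurry u) (Ioo 0 T₀ ×ˢ ball xc (4 * rc)) →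
      ContDiffOn ℝ ∞ (uncurry p) (Ioo 0 T₀ ×ˢ ball xc (4 * rc)) →
      (∀ t ∈ Ioo 0 T₀, ∀ x ∈ ball xc (4 * rc),
        deriv (fun s => u s x) t + convect (u t) (u t) x = Δ (u t) x - gradient (p t) x) →
      (∀ t ∈ Ioo 0 T₀, ∀ x ∈ ball xc (4 * rc), VectorCalculus.divergence (u t) x = 0) →
      ∀ ⦃A B D : ℝ⦄, 0 ≤ A → 0 ≤ B → 0 ≤ D →
      (∀ t ∈ Ioo 0 T₀, eLpNorm (u t) (ENNReal.ofReal q)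
          (volume.restrict (ball xc (4 * rc))) ≤ ENNReal.ofReal A) →
      (∀ t ∈ Ioo 0 T₀, eLpNorm (p t) (ENNReal.ofReal (q / 2))
          (volume.restrict (ball xc (4 * rc))) ≤ ENNReal.ofReal (B ^ 2)) →
      (∫⁻ t in Ioo 0 T₀, eLpNorm (fun x => Real.sqrt (frobeniusNormSq (fderiv ℝ (u t) x)))
          (ENNReal.ofReal q) (volume.restrict (ball xc (4 * rc))) ^ r ≤
        ENNReal.ofReal (D ^ r)) →
      ∀ t ∈ Ioo 0 (C⁻¹ * min (min T₀ (rc ^ 2))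
          (q ^ 2 * (C * (A + B + T₀ ^ ((r - 2) / (2 * r)) * D)) ^ (2 * q / (q - 3)))⁻¹),
        ∃ U : EuclideanSpace ℂ (Fin 3) → EuclideanSpace ℂ (Fin 3),
          DifferentiableOn ℂ U (localComplexTube xc rc (Real.sqrt t / (4 * C₀))) ∧
          (∀ z ∈ localComplexTube xc rc (Real.sqrt t / (4 * C₀)), ‖U z‖ ≤ 2 * K / Real.sqrt t) ∧
          ∀ x ∈ ball xc rc, U (complexify x) = complexify (u t x) := by
  have hR0 : 0 < R := by linarith
  have hR2 : 0 < R ^ 2 := by positivity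
  -- the `q`-free Hölder constant on balls of radius `R`
  set W : ℝ≥0∞ := max 1 (volume (ball (0 : EuclideanSpace ℝ (Fin 3)) R)) with hW
  have hWtop : W ≠ ⊤ := (max_lt ENNReal.one_lt_top measure_ball_lt_top).ne
  set Wr : ℝ := W.toReal with hWr
  have hWofReal : W = ENNReal.ofReal Wr := (ENNReal.ofReal_toReal hWtop).symm
  have hWr1 : 1 ≤ Wr := by
    have := ENNReal.toReal_mono hWtop (le_max_left _ _ : (1 : ℝ≥0∞) ≤ W)
    rwa [ENNReal.toReal_one] at this
  have hWr0 : 0 < Wr := one_pos.trans_le hWr1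
  -- the constant `C`
  set C : ℝ := R ^ 2 + 9 + Wr / ε₀ + (1 + R ^ 2) * Wr ^ 2 / ε₀ ^ 2 with hCdef
  have ht1 : 0 ≤ Wr / ε₀ := by positivity
  have ht2 : 0 ≤ (1 + R ^ 2) * Wr ^ 2 / ε₀ ^ 2 := by positivity
  have hCR : R ^ 2 + 9 ≤ C := by rw [hCdef]; linarith
  have hC1 : 1 ≤ C := by linarith
  have hCpos : 0 < C := by linarith
  have hCW : Wr / ε₀ ≤ C := by rw [hCdef]; linarith
  have hCW2 : (1 + R ^ 2) * Wr ^ 2 / ε₀ ^ 2 ≤ C := by rw [hCdef]; linarith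
  have hWC : Wr / C ≤ ε₀ := by
    rw [div_le_iff₀ hCpos]
    rw [div_le_iff₀ hε₀] at hCW
    linarith [mul_comm ε₀ C]
  have hWC2 : Wr ^ 2 * ((1 + R ^ 2) / C) ≤ ε₀ ^ 2 := by
    rw [mul_div_assoc', div_le_iff₀ hCpos]
    rw [div_le_iff₀ (by positivity : (0 : ℝ) < ε₀ ^ 2)] at hCW2
    linarith [mul_comm (ε₀ ^ 2) C]
  have hunit : ∀ ⦃rc T₀ q r δ : ℝ⦄, 0 < rc → 0 < T₀ → 3 < q → 2 * q / (q - 3) < r → 0 < δ →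
      ∀ ⦃u : ℝ → EuclideanSpace ℝ (Fin 3) → EuclideanSpace ℝ (Fin 3)⦄
        ⦃p : ℝ → EuclideanSpace ℝ (Fin 3) → ℝ⦄,
        ContDiffOn ℝ ∞ (uncurry u) (Ioo (-δ) T₀ ×ˢ ball (0 : EuclideanSpace ℝ (Fin 3)) (4 * rc)) →
        ContDiffOn ℝ ∞ (uncurry p) (Ioo (-δ) T₀ ×ˢ ball (0 : EuclideanSpace ℝ (Fin 3)) (4 * rc)) →
        (∀ t ∈ Ioo (-δ) T₀, ∀ x ∈ ball (0 : EuclideanSpace ℝ (Fin 3)) (4 * rc),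
          deriv (fun s => u s x) t + convect (u t) (u t) x = Δ (u t) x - gradient (p t) x) →
        (∀ t ∈ Ioo (-δ) T₀, ∀ x ∈ ball (0 : EuclideanSpace ℝ (Fin 3)) (4 * rc), VectorCalculus.divergence (u t) x = 0) →
        ∀ ⦃A B D : ℝ⦄, 0 ≤ A → 0 ≤ B → 0 ≤ D →
        (∀ t ∈ Ioo (-δ) T₀, eLpNorm (u t) (ENNReal.ofReal q)
            (volume.restrict (ball (0 : EuclideanSpace ℝ (Fin 3)) (4 * rc))) ≤ ENNReal.ofReal A) →
        (∀ t ∈ Ioo (-δ) T₀, eLpNorm (p t) (ENNReal.ofReal (q / 2))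
            (volume.restrict (ball (0 : EuclideanSpace ℝ (Fin 3)) (4 * rc))) ≤ ENNReal.ofReal (B ^ 2)) →
        (∫⁻ t in Ioo (-δ) T₀, eLpNorm (fun x => Real.sqrt (frobeniusNormSq (fderiv ℝ (u t) x)))
            (ENNReal.ofReal q) (volume.restrict (ball (0 : EuclideanSpace ℝ (Fin 3)) (4 * rc))) ^ r ≤
          ENNReal.ofReal (D ^ r)) →
      1 < C⁻¹ * min (min T₀ (rc ^ 2))
        (q ^ 2 * (C * (A + B + T₀ ^ ((r - 2) / (2 * r)) * D)) ^ (2 * q / (q - 3)))⁻¹ →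
      ∃ U : EuclideanSpace ℂ (Fin 3) → EuclideanSpace ℂ (Fin 3),
        DifferentiableOn ℂ U (localComplexTube 0 rc (1 / (4 * C₀))) ∧
        (∀ z ∈ localComplexTube 0 rc (1 / (4 * C₀)), ‖U z‖ ≤ K) ∧
        ∀ x ∈ ball (0 : EuclideanSpace ℝ (Fin 3)) rc, U (complexify x) = complexify (u 1 x) := by
    intro rc T₀ q r δ hrc hT₀ hq hr hδ u p hu hp hns hdiv A B D hA hB hD huA hpB hgrad hwin
    obtain ⟨hCT, hCrc, hAC, hBC, hDC⟩ := bgk_small_of_window hC1 hT₀ hq hr hA hB hD hwin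
    have hRrc : R ≤ rc := by
      by_contra hcon
      have : rc ^ 2 ≤ R ^ 2 := pow_le_pow_left₀ hrc.le (not_le.1 hcon).le 2
      linarith
    have hTR : R ^ 2 ≤ T₀ := by linarith
    have hq0 : 0 < q := by linarith
    have hr2 : 2 < r := by
      have h1 : (2 : ℝ) < 2 * q / (q - 3) := by
        rw [lt_div_iff₀ (by linarith)]; nlinarith
      exact h1.trans hr
    have h1C : 1 / C ≤ 1 := by rw [div_le_one hCpos]; exact hC1
    -- cover `B(0, r_*)` by unit balls
    refine exists_differentiableOn_localComplexTube_of_forall_unit_ball_norm_le fun x₁ hx₁ => ?_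
    have hsub : ball x₁ R ⊆ ball (0 : EuclideanSpace ℝ (Fin 3)) (4 * rc) :=
      ball_subset_ball_four_mul hRrc hx₁
    have hIoo : Ioo (-δ) (R ^ 2) ⊆ Ioo (-δ) T₀ := Ioo_subset_Ioo le_rfl hTR
    have hcyl : Ioo (-δ) (R ^ 2) ×ˢ ball x₁ R ⊆
        Ioo (-δ) T₀ ×ˢ ball (0 : EuclideanSpace ℝ (Fin 3)) (4 * rc) :=
      prod_mono hIoo hsub
    have hμ : volume.restrict (ball x₁ R) ≤
        volume.restrict (ball (0 : EuclideanSpace ℝ (Fin 3)) (4 * rc)) :=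
      Measure.restrict_mono hsub le_rfl
    have hWx : max 1 ((volume.restrict (ball x₁ R)) univ) = W := by
      rw [Measure.restrict_apply_univ, (volume_ball_eq_volume_ball_zero x₁ R).1]
    have h3q : (3 : ℝ≥0∞) ≤ ENNReal.ofReal q := by
      rw [show (3 : ℝ≥0∞) = ENNReal.ofReal 3 by norm_num]
      exact ENNReal.ofReal_le_ofReal hq.le
    have h32q : ENNReal.ofReal (3 / 2) ≤ ENNReal.ofReal (q / 2) :=
      ENNReal.ofReal_le_ofReal (by linarith)
    have h132 : (1 : ℝ≥0∞) ≤ ENNReal.ofReal (3 / 2) := by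
      rw [← ENNReal.ofReal_one]; exact ENNReal.ofReal_le_ofReal (by norm_num)
    have h2q : (2 : ℝ≥0∞) ≤ ENNReal.ofReal q := by
      rw [show (2 : ℝ≥0∞) = ENNReal.ofReal 2 by norm_num]
      exact ENNReal.ofReal_le_ofReal (by linarith)
    refine hsmall x₁ hδ (hu.mono hcyl) (hp.mono hcyl)
      (fun t ht x hx => hns t (hIoo ht) x (hsub hx)) (fun t ht x hx => hdiv t (hIoo ht) x (hsub hx))
      (fun t ht => ?_) (fun t ht => ?_) ?_
    · -- `L³`
      have hmeas : AEStronglyMeasurable (u t) (volume.restrict (ball x₁ R)) :=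
        aestronglyMeasurable_slice_of_contDiffOn (hu.mono hcyl) measurableSet_ball ht
      calc eLpNorm (u t) 3 (volume.restrict (ball x₁ R))
          ≤ eLpNorm (u t) (ENNReal.ofReal q) (volume.restrict (ball x₁ R)) *
              max 1 ((volume.restrict (ball x₁ R)) univ) :=
            eLpNorm_le_eLpNorm_mul_max_one_measure (by norm_num) h3q hmeas
        _ ≤ eLpNorm (u t) (ENNReal.ofReal q)
              (volume.restrict (ball (0 : EuclideanSpace ℝ (Fin 3)) (4 * rc))) * W := by
            rw [hWx]
            exact mul_le_mul' (eLpNorm_mono_measure _ hμ) le_rfl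
        _ ≤ ENNReal.ofReal (1 / C) * W :=
            mul_le_mul' ((huA t (hIoo ht)).trans (ENNReal.ofReal_le_ofReal hAC.le)) le_rfl
        _ = ENNReal.ofReal (Wr / C) := by
            rw [hWofReal, ← ENNReal.ofReal_mul (by positivity)]
            congr 1
            ring
        _ ≤ ENNReal.ofReal ε₀ := ENNReal.ofReal_le_ofReal hWC
    · -- `L^{3/2}` (pressure)
      have hmeas : AEStronglyMeasurable (p t) (volume.restrict (ball x₁ R)) :=
        aestronglyMeasurable_slice_of_contDiffOn (hp.mono hcyl) measurableSet_ball ht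
      have hB2 : B ^ 2 ≤ 1 / C := by
        have hB1 : B ≤ 1 := hBC.le.trans h1C
        nlinarith
      calc eLpNorm (p t) (ENNReal.ofReal (3 / 2)) (volume.restrict (ball x₁ R))
          ≤ eLpNorm (p t) (ENNReal.ofReal (q / 2)) (volume.restrict (ball x₁ R)) *
              max 1 ((volume.restrict (ball x₁ R)) univ) :=
            eLpNorm_le_eLpNorm_mul_max_one_measure h132 h32q hmeas
        _ ≤ eLpNorm (p t) (ENNReal.ofReal (q / 2))
              (volume.restrict (ball (0 : EuclideanSpace ℝ (Fin 3)) (4 * rc))) * W := by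
            rw [hWx]
            exact mul_le_mul' (eLpNorm_mono_measure _ hμ) le_rfl
        _ ≤ ENNReal.ofReal (1 / C) * W :=
            mul_le_mul' ((hpB t (hIoo ht)).trans (ENNReal.ofReal_le_ofReal hB2)) le_rfl
        _ = ENNReal.ofReal (Wr / C) := by
            rw [hWofReal, ← ENNReal.ofReal_mul (by positivity)]
            congr 1
            ring
        _ ≤ ENNReal.ofReal ε₀ := ENNReal.ofReal_le_ofReal hWC
    · -- `L²_t L²_x` (gradient)
      set G : ℝ → ℝ≥0∞ := fun t =>
        eLpNorm (fun x => Real.sqrt (frobeniusNormSq (fderiv ℝ (u t) x))) (ENNReal.ofReal q)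
          (volume.restrict (ball (0 : EuclideanSpace ℝ (Fin 3)) (4 * rc))) with hG
      have hG8 : ∀ t ∈ Ioo (0 : ℝ) (R ^ 2),
          eLpNorm (fun x => Real.sqrt (frobeniusNormSq (fderiv ℝ (u t) x))) 2
            (volume.restrict (ball x₁ R)) ^ (2 : ℝ) ≤ W ^ (2 : ℝ) * G t ^ (2 : ℝ) := by
        intro t ht
        have ht' : t ∈ Ioo (-δ) T₀ := ⟨by linarith [ht.1], by linarith [ht.2]⟩
        have hmeas : AEStronglyMeasurable
            (fun x => Real.sqrt (frobeniusNormSq (fderiv ℝ (u t) x)))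
            (volume.restrict (ball x₁ R)) :=
          aestronglyMeasurable_sqrt_frobeniusNormSq_fderiv_slice isOpen_ball
            (hu.mono (prod_mono Subset.rfl hsub)) ht'
        have h1 : eLpNorm (fun x => Real.sqrt (frobeniusNormSq (fderiv ℝ (u t) x))) 2
            (volume.restrict (ball x₁ R)) ≤ G t * W := by
          calc eLpNorm (fun x => Real.sqrt (frobeniusNormSq (fderiv ℝ (u t) x))) 2
                (volume.restrict (ball x₁ R))
              ≤ eLpNorm (fun x => Real.sqrt (frobeniusNormSq (fderiv ℝ (u t) x)))
                  (ENNReal.ofReal q) (volume.restrict (ball x₁ R)) *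
                  max 1 ((volume.restrict (ball x₁ R)) univ) :=
                eLpNorm_le_eLpNorm_mul_max_one_measure (by norm_num) h2q hmeas
            _ ≤ G t * W := by
                rw [hWx]
                exact mul_le_mul' (eLpNorm_mono_measure _ hμ) le_rfl
        calc eLpNorm (fun x => Real.sqrt (frobeniusNormSq (fderiv ℝ (u t) x))) 2
              (volume.restrict (ball x₁ R)) ^ (2 : ℝ)
            ≤ (G t * W) ^ (2 : ℝ) := ENNReal.rpow_le_rpow h1 (by norm_num)
          _ = W ^ (2 : ℝ) * G t ^ (2 : ℝ) := by
              rw [ENNReal.mul_rpow_of_nonneg _ _ (by norm_num), mul_comm]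
      have hGr : ∫⁻ t in Ioo (0 : ℝ) (R ^ 2), G t ^ r ≤ ENNReal.ofReal (D ^ r) :=
        (lintegral_mono_set (Ioo_subset_Ioo (by linarith) hTR)).trans hgrad
      have hvol : volume (Ioo (0 : ℝ) (R ^ 2)) ≤ ENNReal.ofReal (R ^ 2) := by
        rw [Real.volume_Ioo, sub_zero]
      have hG2 : ∫⁻ t in Ioo (0 : ℝ) (R ^ 2), G t ^ (2 : ℝ) ≤ ENNReal.ofReal ((1 + R ^ 2) / C) :=
        lintegral_sq_le_of_lintegral_rpow_le hC1 hr2 hD hDC hR2.le hvol hGr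
      have hW2 : W ^ (2 : ℝ) = ENNReal.ofReal (Wr ^ 2) := by
        rw [hWofReal, ENNReal.ofReal_rpow_of_nonneg hWr0.le (by norm_num), Real.rpow_two]
      calc ∫⁻ t in Ioo (0 : ℝ) (R ^ 2),
            eLpNorm (fun x => Real.sqrt (frobeniusNormSq (fderiv ℝ (u t) x))) 2
              (volume.restrict (ball x₁ R)) ^ (2 : ℝ)
          ≤ ∫⁻ t in Ioo (0 : ℝ) (R ^ 2), W ^ (2 : ℝ) * G t ^ (2 : ℝ) :=
            setLIntegral_mono' measurableSet_Ioo fun t ht => hG8 t ht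
        _ = W ^ (2 : ℝ) * ∫⁻ t in Ioo (0 : ℝ) (R ^ 2), G t ^ (2 : ℝ) :=
            lintegral_const_mul' _ _ (by rw [hW2]; exact ENNReal.ofReal_ne_top)
        _ ≤ W ^ (2 : ℝ) * ENNReal.ofReal ((1 + R ^ 2) / C) := mul_le_mul' le_rfl hG2
        _ = ENNReal.ofReal (Wr ^ 2 * ((1 + R ^ 2) / C)) := by
            rw [hW2, ← ENNReal.ofReal_mul (by positivity)]
        _ ≤ ENNReal.ofReal (ε₀ ^ 2) := ENNReal.ofReal_le_ofReal hWC2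
  refine ⟨C, hCpos, ?_⟩
  intro xc rc T₀ q r hrc hT₀ hq hr u p hu hp hns hdiv A B D hA hB hD huA hpB hgrad t ht
  exact bgk_supBound_of_core hC₀ hC1 hK (fun xc' rc' T₀' q' r' δ hrc' hT₀' hq' hr' hδ u' p'
    hu' hp' hns' hdiv' A' B' D' hA' hB' hD' huA' hpB' hgrad' t' ht' =>
    bgk_core_of_core_unit_norm_le (one_pos.trans_le hC1) hunit xc' hrc' hT₀' hq' hr' hδ hu' hp'
      hns' hdiv' hA' hB' hD' huA' hpB' hgrad' ht') xc hrc hq hr hu hp hns hdiv hA hB hD huA hpB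
    hgrad ht

/-! ### The theorem -/

/-- **Bradshaw–Grujić–Kukavica's local analyticity radius theorem WITH THE SUP BOUND OF THE
EXTENSION.** There are universal constants `C₀, C, C₁ > 0` such that for every centre `x_*`,
radius `r_* > 0`, time `T₀ > 0`, exponents `q > 3`, `r > 2q/(q−3)`, every pair `(u, p)` jointly
`C^∞` on `(0,T₀) × 4B_*` solving there `∂ₜu + (u·∇)u = Δu − ∇p`, `div u = 0` pointwise, and all
majorants `A, B, D ≥ 0` of `sup_t ‖u(t)‖_{L^q(4B_*)}`, `sup_t ‖p(t)‖^{1/2}_{L^{q/2}(4B_*)}`,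
`(∫₀^{T₀} ‖∇u‖^r_{L^q(4B_*)})^{1/r}` — the hypotheses of the named fact
`bradshawGrujicKukavica2015_local_analyticity_radius` VERBATIM — every slice `u(t)`,
`0 < t < T₁ = C⁻¹ min{T₀, r_*², (q²(CM)^{2q/(q−3)})⁻¹}`, `M = A + B + T₀^{(r−2)/(2r)} D`, agrees on
`B_*` with a map `U : ℂ³ → ℂ³` complex-differentiable on
`Ω_*(t) = localComplexTube x_* r_* (√t/(4C₀))` AND BOUNDED THERE BY `C₁/√t`. This is the printed
theorem (BGK 2015 Thm. 2.3 = BGK 2016 Thm. 2.3.1) together with the bound its proof carries: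
the approximations of the contour scheme are uniformly bounded on the bent fibres — (4.9), p. 19,
"for all `n`, `sup_t ‖U_α^{(n)}(t)‖_{L^q(4B_*)} + sup_t ‖V_α^{(n)}(t)‖_{L^q(4B_*)} ≤ 5M_loc`";
BGK 2016 (2.1)/(2.4) — and so is their limit (p. 15); in the tree's `ε`-regular unit-scale
normalisation the scheme's bound is the sup bound `ρ₀` (`BGK2015.picardW_spec`), which rescales
to `C₁/√t`. Proof: `BGK2015.exists_small_unitScale_extension_norm_le` and `bgk_supBound_of_small`
(`R = 12`); forgetting the bound gives back the fact
(`bradshawGrujicKukavica2015_local_analyticity_radius_holds`). The holomorphic extension is unique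
(`eqOn_localComplexTube_of_forall_complexify_eq`), so the bound applies to the extension provided
by `…_holds` on the common region as well.
[cite: BradshawGrujicKukavica2015, Thm. 2.3 (pp. 4–5), Lemma 3.2, (4.9) (p. 19), proof of Thm. 2.1 (p. 15)] [cite: BradshawGrujicKukavica2016, Thm. 2.3.1 and (2.1)–(2.4) (pp. 29–30)] -/
theorem bradshawGrujicKukavica2015_local_analyticity_radius_supBound :
    ∃ C₀ C C₁ : ℝ, 0 < C₀ ∧ 0 < C ∧ 0 < C₁ ∧
    ∀ (xc : EuclideanSpace ℝ (Fin 3)) ⦃rc T₀ q r : ℝ⦄, 0 < rc → 0 < T₀ → 3 < q →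
      2 * q / (q - 3) < r →
    ∀ ⦃u : ℝ → EuclideanSpace ℝ (Fin 3) → EuclideanSpace ℝ (Fin 3)⦄
      ⦃p : ℝ → EuclideanSpace ℝ (Fin 3) → ℝ⦄,
      ContDiffOn ℝ ∞ (uncurry u) (Ioo 0 T₀ ×ˢ ball xc (4 * rc)) →
      ContDiffOn ℝ ∞ (uncurry p) (Ioo 0 T₀ ×ˢ ball xc (4 * rc)) →
      (∀ t ∈ Ioo 0 T₀, ∀ x ∈ ball xc (4 * rc),
        deriv (fun s => u s x) t + convect (u t) (u t) x = Δ (u t) x - gradient (p t) x) →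
      (∀ t ∈ Ioo 0 T₀, ∀ x ∈ ball xc (4 * rc), VectorCalculus.divergence (u t) x = 0) →
      ∀ ⦃A B D : ℝ⦄, 0 ≤ A → 0 ≤ B → 0 ≤ D →
      (∀ t ∈ Ioo 0 T₀, eLpNorm (u t) (ENNReal.ofReal q)
          (volume.restrict (ball xc (4 * rc))) ≤ ENNReal.ofReal A) →
      (∀ t ∈ Ioo 0 T₀, eLpNorm (p t) (ENNReal.ofReal (q / 2))
          (volume.restrict (ball xc (4 * rc))) ≤ ENNReal.ofReal (B ^ 2)) →
      (∫⁻ t in Ioo 0 T₀, eLpNorm (fun x => Real.sqrt (frobeniusNormSq (fderiv ℝ (u t) x)))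
          (ENNReal.ofReal q) (volume.restrict (ball xc (4 * rc))) ^ r ≤
        ENNReal.ofReal (D ^ r)) →
      ∀ t ∈ Ioo 0 (C⁻¹ * min (min T₀ (rc ^ 2))
          (q ^ 2 * (C * (A + B + T₀ ^ ((r - 2) / (2 * r)) * D)) ^ (2 * q / (q - 3)))⁻¹),
        ∃ U : EuclideanSpace ℂ (Fin 3) → EuclideanSpace ℂ (Fin 3),
          DifferentiableOn ℂ U (localComplexTube xc rc (Real.sqrt t / (4 * C₀))) ∧
          (∀ z ∈ localComplexTube xc rc (Real.sqrt t / (4 * C₀)), ‖U z‖ ≤ C₁ / Real.sqrt t) ∧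
          ∀ x ∈ ball xc rc, U (complexify x) = complexify (u t x) := by
  obtain ⟨ε₀, C₀, K, hε₀, hC₀, hK, hsmall⟩ := BGK2015.exists_small_unitScale_extension_norm_le
  obtain ⟨C, hC, h⟩ := bgk_supBound_of_small (R := 12) (by norm_num) hε₀ hC₀ hK.le hsmall
  exact ⟨C₀, C, 2 * K, hC₀, hC, by positivity, h⟩

end Literature.Analysis.FluidPDE
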